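import Mathlib
import HarnessLib
import Literature.MathematicalPhysics.StatisticalMechanics.TuningLipschitzTorusFRD
import Literature.MathematicalPhysics.StatisticalMechanics.InitialActivityHamiltonianBundled
import Literature.Dynamics.Hyperbolic.RGFlowStableManifoldTuningMap

/-!
# [ABKM19] Lemma 12.6 ASSEMBLED for the torus data: the tuned initial relevant Hamiltonian
# `ℋ = Π_{H_0} Ẑ(𝒦, ℋ)` exists, given the `S_k`-comparison (12.53) in the tuning parameter

For ONE finite-range-decomposition package `𝒞_{A,k}` on `(ℤ/L^N)^d` (clauses (o)–(v) of
`GradientFRD.TorusFRD d`), the weight tower of Theorem 7.1 for `𝒞_{1,k}` (`AbkmWeightBounds`, norms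
`P = abkmNormParams …`), the step-kernel families `𝒞s_q = (j ↦ 𝒞_{1+q,j})` of symmetric tuning
parameters `q` in the ball `Σ|q_{ij}| ≤ T₀` (`T₀ ≤ ½`, `K T₀ ≤ log(1+θ)`, `θ < θ̄`), the steps
`(rgA L h 𝒞s_q, rgBQ(𝒞s_q), rgSQ 𝒞s_q)` (`RGStepABKMQ`) and the initial activity
`y₀(ℋ) = K̂_0(𝒦, ℋ)` (`initAct`), this file feeds

* `hT` — Theorem 6.8 for every `q` in the ball (`isRGStepQ_abkm_of_stepKernelBounds` ∘
  `stepKernelBounds_family_of_torusFRD`),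
* `ha`, `hb` — (12.51), (12.52) globally on the ball (`TuningLipschitzTorusFRD`),
* `hy₀`, `hm` — Lemma 12.2 (`activityNormLE_initAct`, `activityNormLE_initAct_sub`),
* **`hl` — (12.53) for `S_k`, taken as a HYPOTHESIS** at the level of the tuning parameter (the
  two-kernel comparison of the renormalisation map; its linear part is `LinearisedMapKernelSubTorusFRD`,
  the second-order remainder is not yet in the tree),

and a tuning map `qmap : E_0 → Sym_d(ℝ)` (symmetric values in the `T₀`-ball, Lipschitz on the `ρ`-ball
for the entry-sum distance) into `RGFlow.exists_isTunedQ_initial_eq_of_parametrised` (Lemma 12.6 by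
Brouwer, `E_0 = M_0(𝓑_0) ⊗ ℂ` finite-dimensional):

* **`rgBT`** — `B_k^{(q)}` as a total function of the tuning parameter (`rgBQ` on the ball, `0` off it);
* **`exists_tuned_initial_of_torusFRD`** — there is `ℋ⋆ ∈ E_0`, `‖ℋ⋆‖ ≤ ρ`, and a tuned relevant
  trajectory `x` of the system `q = qmap ℋ⋆` started from `y₀(ℋ⋆)`, in the `ε`-tube, with `x_0 = ℋ⋆`
  ((12.50)).

Everything is proved; no named fact.  Honest scope: the conclusion is CONDITIONAL on the hypothesis
`hl` (12.53); the side conditions on `A, r, L` are those of `RGStepABKMQ` verbatim; nothing here is the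
representation of `𝒵_N` (Ch. 4) or its non-vanishing.

## References
* S. Adams, S. Buchholz, R. Kotecký, S. Müller, arXiv:1910.13564, Lemma 12.6 (12.50)–(12.56),
  Theorem 6.8, Lemma 12.2, Definition 6.5 [AdamsBuchholzKoteckyMuller2019].
* S. Buchholz, J. Funct. Anal. 275 (2018), Thm 2.4 [Buchholz2016].
-/

noncomputable section

namespace Literature.MathematicalPhysics.StatisticalMechanics.GradientRG

open scoped BigOperators
open Real Set Finset MeasureTheory
open Literature.MathematicalPhysics.StatisticalMechanics.GradientFRD
  (fourierCoeff cExt cExt_of_mem IsElliptic IsUnitSymm InShell iterDiff supNorm conv ellOp isElliptic_one)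
open Literature.MathematicalPhysics.StatisticalMechanics.TorusPolymer (IsPolymer numBlocks blockOf boxCorner)
open Literature.Barriers.CriticalPhenomena.LongRangePhi4.Polymer (IsConn)
open Literature.MathematicalPhysics.QuantumFieldTheory
open Literature.Dynamics.Hyperbolic

variable {d M : ℕ} [NeZero M]

section Package

variable {L N Mord R n ñ : ℕ} {θbar lam μ δ₁ δ₀ A𝒫 : ℝ}
    {𝒞 : Matrix (Fin d) (Fin d) ℝ → ℕ → (Fin d → ZMod M) → ℝ} {Mc : ℕ → ℝ}
    {Cα : (Fin d → ℕ) → ℕ → ℝ} {c C : ℝ} {Cℓ : ℕ → ℝ}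

/-- **`B_k^{(q)}` as a total function of the tuning parameter**: `rgBQ` for the family `𝒞s_q` when `q`
is symmetric with `Σ|q_{ij}| ≤ T₀` (its `StepKernelBounds` family from the package), `0` otherwise.
[cite: AdamsBuchholzKoteckyMuller2019, Theorem 6.8 / Lemma 12.6] -/
def rgBT {h : ℝ}
    (hd : 3 ≤ d) (hMord : 1 ≤ Mord) (hMR : Mord ≤ R) (hLodd : Odd L) (hL : 2 ^ (d + 3) + 16 * R ≤ L)
    (hM : M = L ^ N)
    (hθbar : 0 < θbar) (hlam : 0 < lam) (hn : 2 * Mord ≤ n) (hn2 : 2 ≤ n) (hnñ : n ≤ ñ)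
    (hc : 0 < c) (hC1 : 0 ≤ Cℓ 1)
    (hallA : ∀ A : Matrix (Fin d) (Fin d) ℝ, IsElliptic (1 / 2 : ℝ) 2 A →
        (∀ k, 1 ≤ k → k ≤ N + 1 →
          ∑ x : Fin d → ZMod M, 𝒞 A k x = 0 ∧ ∀ x, 𝒞 A k (-x) = 𝒞 A k x) ∧
        (∀ k, 1 ≤ k → k ≤ N + 1 → ∀ φ : (Fin d → ZMod M) → ℝ, ∑ x, φ x = 0 →
          0 ≤ ∑ x, ∑ y, φ x * 𝒞 A k (x - y) * φ y) ∧
        (∀ φ : (Fin d → ZMod M) → ℝ, ∑ x, φ x = 0 →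
          ellOp A (conv (fun x => ∑ k ∈ Finset.Icc 1 (N + 1), 𝒞 A k x) φ) = φ) ∧
        (∀ k, 1 ≤ k → k ≤ N → Mc k ≤ 0 ∧
          ∀ x : Fin d → ZMod M, ((L : ℝ) ^ k) / 2 ≤ (supNorm x : ℝ) →
            𝒞 A k x = Mc k) ∧
        (∀ k, 1 ≤ k → k ≤ N + 1 → ∀ B : Matrix (Fin d) (Fin d) ℝ, IsUnitSymm B →
          (∃ ε : ℝ, 0 < ε ∧ ∀ x : Fin d → ZMod M,
            ContDiffOn ℝ ⊤ (fun s : ℝ => 𝒞 (A + s • B) k x) (Set.Ioo (-ε) ε)) ∧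
          ∀ α : Fin d → ℕ, ∑ i, α i ≤ n → ∀ ℓ : ℕ, ∀ x : Fin d → ZMod M,
            abs (iteratedDeriv ℓ (fun s : ℝ => iterDiff α (𝒞 (A + s • B) k) x) 0)
              ≤ Cα α ℓ / (L : ℝ) ^ ((k - 1) * (d - 2 + ∑ i, α i))) ∧
        (∀ k, 1 ≤ k → k ≤ N + 1 → ∀ j : ℕ, ∀ κ : Fin d → ZMod M, κ ≠ 0 → InShell L j κ →
          (j < k →
            c / (L : ℝ) ^ (2 * (d + ñ) + 1) * (L : ℝ) ^ (2 * j)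
                / (L : ℝ) ^ ((k - j) * (d - 1 + n)) ≤ (fourierCoeff (𝒞 A k) κ).re ∧
            ‖fourierCoeff (𝒞 A k) κ‖
              ≤ C * (L : ℝ) ^ (2 * (d + ñ) + 1) * (L : ℝ) ^ (2 * j)
                  / (L : ℝ) ^ ((k - j) * (d - 1 + n))) ∧
          (k ≤ j →
            c / (L : ℝ) ^ (2 * (d + ñ) + 1) * (L : ℝ) ^ (2 * k)
                ≤ (fourierCoeff (𝒞 A k) κ).re ∧
            ‖fourierCoeff (𝒞 A k) κ‖ ≤ C * (L : ℝ) ^ (2 * k)) ∧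
          ∀ B : Matrix (Fin d) (Fin d) ℝ, IsUnitSymm B → ∀ ℓ : ℕ, 1 ≤ ℓ →
            (j < k →
              ‖iteratedDeriv ℓ (fun s : ℝ => fourierCoeff (𝒞 (A + s • B) k) κ) 0‖
                ≤ Cℓ ℓ * (L : ℝ) ^ (2 * (d + ñ) + 1) * (L : ℝ) ^ (2 * j)
                    / (L : ℝ) ^ ((k - j) * (d - 1 + ñ))) ∧
            (k ≤ j →
              ‖iteratedDeriv ℓ (fun s : ℝ => fourierCoeff (𝒞 (A + s • B) k) κ) 0‖
                ≤ Cℓ ℓ * (L : ℝ) ^ (2 * k))))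
    (hB : AbkmWeightBounds L N Mord R n θbar lam μ δ₁ δ₀ A𝒫 (fun j => 𝒞 1 j)
      (abkmWeightData L N Mord R θbar (schedDelta δ₀ δ₁ N) fun j => 𝒞 1 j))
    (pT r₀ : ℕ) (hr₀ : 3 ≤ r₀) (A : ℝ)
    {θ : ℝ} (hθ0 : 0 ≤ θ) (hθ : θ < θbar)
    {T₀ : ℝ} (hT₀ : T₀ ≤ 1 / 2) (hKT₀ : shellRatioConst c (Cℓ 1) (L : ℝ) d ñ * T₀ ≤ Real.log (1 + θ))
    (q : Matrix (Fin d) (Fin d) ℝ) (k : ℕ) :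
    activitySpace (abkmNormParams L N Mord R pT r₀ h θbar A (schedDelta δ₀ δ₁ N) fun j => 𝒞 1 j) k →+
      HamSpace ℂ d (fieldWt h (L : ℝ) d (k + 1)) ((L : ℝ) ^ (k + 1)) (L ^ (d * (k + 1))) :=
  if hq : q.IsSymm ∧ ∑ i, ∑ j, |q i j| ≤ T₀ then
    rgBQ (p := pT) (A := A) hB (by omega) hLodd hM
      (stepKernelBounds_family_of_torusFRD hd hMord hMR hLodd hL hθbar hlam hn hn2 hnñ hc hC1 hallA hB
        hθ0 hθ hT₀ hKT₀ hq.1 hq.2) k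
  else 0

/-- On the ball, `rgBT` is `rgBQ` of the family `𝒞s_q`. [cite: AdamsBuchholzKoteckyMuller2019, Theorem 6.8] -/
theorem rgBT_of_mem {h : ℝ}
    (hd : 3 ≤ d) (hMord : 1 ≤ Mord) (hMR : Mord ≤ R) (hLodd : Odd L) (hL : 2 ^ (d + 3) + 16 * R ≤ L)
    (hM : M = L ^ N)
    (hθbar : 0 < θbar) (hlam : 0 < lam) (hn : 2 * Mord ≤ n) (hn2 : 2 ≤ n) (hnñ : n ≤ ñ)
    (hc : 0 < c) (hC1 : 0 ≤ Cℓ 1)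
    (hallA : ∀ A : Matrix (Fin d) (Fin d) ℝ, IsElliptic (1 / 2 : ℝ) 2 A →
        (∀ k, 1 ≤ k → k ≤ N + 1 →
          ∑ x : Fin d → ZMod M, 𝒞 A k x = 0 ∧ ∀ x, 𝒞 A k (-x) = 𝒞 A k x) ∧
        (∀ k, 1 ≤ k → k ≤ N + 1 → ∀ φ : (Fin d → ZMod M) → ℝ, ∑ x, φ x = 0 →
          0 ≤ ∑ x, ∑ y, φ x * 𝒞 A k (x - y) * φ y) ∧
        (∀ φ : (Fin d → ZMod M) → ℝ, ∑ x, φ x = 0 →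
          ellOp A (conv (fun x => ∑ k ∈ Finset.Icc 1 (N + 1), 𝒞 A k x) φ) = φ) ∧
        (∀ k, 1 ≤ k → k ≤ N → Mc k ≤ 0 ∧
          ∀ x : Fin d → ZMod M, ((L : ℝ) ^ k) / 2 ≤ (supNorm x : ℝ) →
            𝒞 A k x = Mc k) ∧
        (∀ k, 1 ≤ k → k ≤ N + 1 → ∀ B : Matrix (Fin d) (Fin d) ℝ, IsUnitSymm B →
          (∃ ε : ℝ, 0 < ε ∧ ∀ x : Fin d → ZMod M,
            ContDiffOn ℝ ⊤ (fun s : ℝ => 𝒞 (A + s • B) k x) (Set.Ioo (-ε) ε)) ∧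
          ∀ α : Fin d → ℕ, ∑ i, α i ≤ n → ∀ ℓ : ℕ, ∀ x : Fin d → ZMod M,
            abs (iteratedDeriv ℓ (fun s : ℝ => iterDiff α (𝒞 (A + s • B) k) x) 0)
              ≤ Cα α ℓ / (L : ℝ) ^ ((k - 1) * (d - 2 + ∑ i, α i))) ∧
        (∀ k, 1 ≤ k → k ≤ N + 1 → ∀ j : ℕ, ∀ κ : Fin d → ZMod M, κ ≠ 0 → InShell L j κ →
          (j < k →
            c / (L : ℝ) ^ (2 * (d + ñ) + 1) * (L : ℝ) ^ (2 * j)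
                / (L : ℝ) ^ ((k - j) * (d - 1 + n)) ≤ (fourierCoeff (𝒞 A k) κ).re ∧
            ‖fourierCoeff (𝒞 A k) κ‖
              ≤ C * (L : ℝ) ^ (2 * (d + ñ) + 1) * (L : ℝ) ^ (2 * j)
                  / (L : ℝ) ^ ((k - j) * (d - 1 + n))) ∧
          (k ≤ j →
            c / (L : ℝ) ^ (2 * (d + ñ) + 1) * (L : ℝ) ^ (2 * k)
                ≤ (fourierCoeff (𝒞 A k) κ).re ∧
            ‖fourierCoeff (𝒞 A k) κ‖ ≤ C * (L : ℝ) ^ (2 * k)) ∧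
          ∀ B : Matrix (Fin d) (Fin d) ℝ, IsUnitSymm B → ∀ ℓ : ℕ, 1 ≤ ℓ →
            (j < k →
              ‖iteratedDeriv ℓ (fun s : ℝ => fourierCoeff (𝒞 (A + s • B) k) κ) 0‖
                ≤ Cℓ ℓ * (L : ℝ) ^ (2 * (d + ñ) + 1) * (L : ℝ) ^ (2 * j)
                    / (L : ℝ) ^ ((k - j) * (d - 1 + ñ))) ∧
            (k ≤ j →
              ‖iteratedDeriv ℓ (fun s : ℝ => fourierCoeff (𝒞 (A + s • B) k) κ) 0‖
                ≤ Cℓ ℓ * (L : ℝ) ^ (2 * k))))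
    (hB : AbkmWeightBounds L N Mord R n θbar lam μ δ₁ δ₀ A𝒫 (fun j => 𝒞 1 j)
      (abkmWeightData L N Mord R θbar (schedDelta δ₀ δ₁ N) fun j => 𝒞 1 j))
    (pT r₀ : ℕ) (hr₀ : 3 ≤ r₀) (A : ℝ)
    {θ : ℝ} (hθ0 : 0 ≤ θ) (hθ : θ < θbar)
    {T₀ : ℝ} (hT₀ : T₀ ≤ 1 / 2) (hKT₀ : shellRatioConst c (Cℓ 1) (L : ℝ) d ñ * T₀ ≤ Real.log (1 + θ))
    {q : Matrix (Fin d) (Fin d) ℝ} (hq : q.IsSymm) (hqT : ∑ i, ∑ j, |q i j| ≤ T₀) :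
    rgBT (h := h) hd hMord hMR hLodd hL hM hθbar hlam hn hn2 hnñ hc hC1 hallA hB pT r₀ hr₀ A hθ0 hθ hT₀ hKT₀ q =
      rgBQ (p := pT) (A := A) (h := h) hB (by omega) hLodd hM
        (stepKernelBounds_family_of_torusFRD hd hMord hMR hLodd hL hθbar hlam hn hn2 hnñ hc hC1 hallA hB
          hθ0 hθ hT₀ hKT₀ hq hqT) := by
  funext k
  unfold rgBT
  rw [dif_pos ⟨hq, hqT⟩]

set_option maxHeartbeats 800000 in
/-- **[ABKM19] Lemma 12.6 assembled for the torus data, given (12.53)** (module docstring): under the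
hypotheses of `RGStepABKMQ.isRGStepQ_abkm_of_stepKernelBounds` (uniformly in the tuning parameter, with
`A_𝒫' = A_𝒫(θ)`), the contraction regime `¾(η+β) ≤ κ`, `σ(r) ≤ κη`, `κ < 1`, `ε ≤ min(r, ρ)`,
`ρ ≤ 1/16`, an initial perturbation `𝒦 ∈ C^{r₀}` with `‖D^s𝒦(z)‖ ≤ ρ_𝒦 e^{|z|²/4}` and
`e^{1/4}ρ_𝒦e^{𝔥_0}A ≤ ε`, `(e^{1/4}+2e^{3/8})ρ_𝒦e^{𝔥_0}A ≤ ½`, a tuning map `qmap` with symmetric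
values in the `T₀`-ball, Lipschitz on the `ρ`-ball for `Σ_{ij}|·|`, and the hypothesis `hl` ((12.53)
for `rgSQ` at the level of the tuning parameter, any constant `l_T ≥ 0`): there is `ℋ⋆`, `‖ℋ⋆‖ ≤ ρ`,
and a tuned relevant trajectory `x` of the system `(rgA, rgBT, rgSQ)` at `q = qmap ℋ⋆` started from
`initAct 𝒦 ℋ⋆`, in the `ε`-tube, with `x_0 = ℋ⋆`. [cite: AdamsBuchholzKoteckyMuller2019, Lemma 12.6] -/
theorem exists_tuned_initial_of_torusFRD {h : ℝ} [Fact (0 < h)] [Fact (0 < L)]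
    (hd : 3 ≤ d) (hMord : 1 ≤ Mord) (hMR : Mord ≤ R) (hLodd : Odd L) (hL : 2 ^ (d + 3) + 16 * R ≤ L)
    (hR2 : 2 ≤ R) (hM : M = L ^ N)
    (hθbar : 0 < θbar) (hlam : 0 < lam) (hn : 2 * Mord ≤ n) (hn2 : 2 ≤ n) (hnñ : n ≤ ñ)
    (hc : 0 < c) (hC1 : 0 ≤ Cℓ 1)
    (hallA : ∀ A : Matrix (Fin d) (Fin d) ℝ, IsElliptic (1 / 2 : ℝ) 2 A →
        (∀ k, 1 ≤ k → k ≤ N + 1 →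
          ∑ x : Fin d → ZMod M, 𝒞 A k x = 0 ∧ ∀ x, 𝒞 A k (-x) = 𝒞 A k x) ∧
        (∀ k, 1 ≤ k → k ≤ N + 1 → ∀ φ : (Fin d → ZMod M) → ℝ, ∑ x, φ x = 0 →
          0 ≤ ∑ x, ∑ y, φ x * 𝒞 A k (x - y) * φ y) ∧
        (∀ φ : (Fin d → ZMod M) → ℝ, ∑ x, φ x = 0 →
          ellOp A (conv (fun x => ∑ k ∈ Finset.Icc 1 (N + 1), 𝒞 A k x) φ) = φ) ∧
        (∀ k, 1 ≤ k → k ≤ N → Mc k ≤ 0 ∧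
          ∀ x : Fin d → ZMod M, ((L : ℝ) ^ k) / 2 ≤ (supNorm x : ℝ) →
            𝒞 A k x = Mc k) ∧
        (∀ k, 1 ≤ k → k ≤ N + 1 → ∀ B : Matrix (Fin d) (Fin d) ℝ, IsUnitSymm B →
          (∃ ε : ℝ, 0 < ε ∧ ∀ x : Fin d → ZMod M,
            ContDiffOn ℝ ⊤ (fun s : ℝ => 𝒞 (A + s • B) k x) (Set.Ioo (-ε) ε)) ∧
          ∀ α : Fin d → ℕ, ∑ i, α i ≤ n → ∀ ℓ : ℕ, ∀ x : Fin d → ZMod M,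
            abs (iteratedDeriv ℓ (fun s : ℝ => iterDiff α (𝒞 (A + s • B) k) x) 0)
              ≤ Cα α ℓ / (L : ℝ) ^ ((k - 1) * (d - 2 + ∑ i, α i))) ∧
        (∀ k, 1 ≤ k → k ≤ N + 1 → ∀ j : ℕ, ∀ κ : Fin d → ZMod M, κ ≠ 0 → InShell L j κ →
          (j < k →
            c / (L : ℝ) ^ (2 * (d + ñ) + 1) * (L : ℝ) ^ (2 * j)
                / (L : ℝ) ^ ((k - j) * (d - 1 + n)) ≤ (fourierCoeff (𝒞 A k) κ).re ∧
            ‖fourierCoeff (𝒞 A k) κ‖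
              ≤ C * (L : ℝ) ^ (2 * (d + ñ) + 1) * (L : ℝ) ^ (2 * j)
                  / (L : ℝ) ^ ((k - j) * (d - 1 + n))) ∧
          (k ≤ j →
            c / (L : ℝ) ^ (2 * (d + ñ) + 1) * (L : ℝ) ^ (2 * k)
                ≤ (fourierCoeff (𝒞 A k) κ).re ∧
            ‖fourierCoeff (𝒞 A k) κ‖ ≤ C * (L : ℝ) ^ (2 * k)) ∧
          ∀ B : Matrix (Fin d) (Fin d) ℝ, IsUnitSymm B → ∀ ℓ : ℕ, 1 ≤ ℓ →
            (j < k →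
              ‖iteratedDeriv ℓ (fun s : ℝ => fourierCoeff (𝒞 (A + s • B) k) κ) 0‖
                ≤ Cℓ ℓ * (L : ℝ) ^ (2 * (d + ñ) + 1) * (L : ℝ) ^ (2 * j)
                    / (L : ℝ) ^ ((k - j) * (d - 1 + ñ))) ∧
            (k ≤ j →
              ‖iteratedDeriv ℓ (fun s : ℝ => fourierCoeff (𝒞 (A + s • B) k) κ) 0‖
                ≤ Cℓ ℓ * (L : ℝ) ^ (2 * k))))
    (hB : AbkmWeightBounds L N Mord R n θbar lam μ δ₁ δ₀ A𝒫 (fun j => 𝒞 1 j)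
      (abkmWeightData L N Mord R θbar (schedDelta δ₀ δ₁ N) fun j => 𝒞 1 j))
    {pT r₀ : ℕ} (hp : d / 2 + 2 ≤ pT) (hpM : pT + d ≤ Mord) (hr₀ : 3 ≤ r₀)
    (hδ₀ : 0 < δ₀) (hδ₁ : 0 < δ₁) (hh0 : hZeroSq d R δ₀ δ₁ ≤ h ^ 2)
    (hh2 : secondDiffConst (fun θ' => Cα θ' 0) ≤ h ^ 2)
    -- the tuning ball
    {θ : ℝ} (hθ0 : 0 ≤ θ) (hθ : θ < θbar)
    {T₀ : ℝ} (hT₀ : T₀ ≤ 1 / 2) (hKT₀ : shellRatioConst c (Cℓ 1) (L : ℝ) d ñ * T₀ ≤ Real.log (1 + θ))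
    {A𝒫' : ℝ} (hA𝒫' : weightIntConstRho θbar θ (traceConst d Mord R lam (derivSum d n fun θ' _ => Cα θ' 0)) = A𝒫')
    -- the side conditions of Theorem 6.8 (`RGStepABKMQ`), at `A_𝒫' = A_𝒫(θ)`
    {A : ℝ} (hA1 : 1 ≤ A) (hA𝒫A : A𝒫' ≤ A)
    (hsmall : (2 : ℝ) ^ (L ^ d) * (A𝒫' * A ^ (-(1 - (1 + 1 / ((2 * (2 ^ d + 1) + 6 : ℝ) ^ d))⁻¹) : ℝ)) ≤ 1)
    {r : ℝ} (hr0 : 0 ≤ r) (hr : r ≤ 1 / 64)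
    (hv : vABKM d R A A𝒫' r ≤ 1 / 64) (hωA : omegaABKM d R A A𝒫' r * A ^ 2 ≤ 1)
    (hc3A : (kappaABKM d R A A𝒫' r) ^ (L ^ d) * ((2 * (2 * (kappaABKM d R A A𝒫' r) * max 1 A𝒫')) ^ ((2 ^ (d + 1) + 2) ^ d * L ^ d) * (4 : ℝ) ^ ((2 ^ (d + 1) + 2) ^ d * L ^ d)) ≤ A ^ ((1 + 1 / ((2 * (2 ^ d + 1) + 6 : ℝ) ^ d)) - 1 : ℝ))
    (hc2A : (kappaABKM d R A A𝒫' r) ^ (L ^ d) * ((2 * (kappaABKM d R A A𝒫' r) * max 1 A𝒫') ^ ((2 ^ (d + 1) + 2) ^ d * L ^ d) * (2 : ℝ) ^ ((2 ^ (d + 1) + 2) ^ d * L ^ d)) ≤ A ^ ((1 + 1 / ((2 * (2 ^ d + 1) + 6 : ℝ) ^ d)) - 1 : ℝ))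
    -- the contraction regime of Ch. 12
    {η κ ε ρ : ℝ} (hη : 0 < η) (hη1 : η ≤ 1)
    (hκ₁ : (3 / 4 : ℝ) * (η + (L : ℝ) ^ d * (pi2BoundConst d (((2 * R + 2 : ℕ) : ℝ) + ((d / 2 + 1 : ℕ) : ℝ)) * (A𝒫' * A⁻¹))) ≤ κ)
    (hκ₂ : sigmaABKM d L R A A𝒫' r ≤ κ * η) (hκ : κ < 1)
    (hε : 0 ≤ ε) (hεr : ε ≤ r) (hερ : ε ≤ ρ) (hρ16 : ρ ≤ 1 / 16)
    -- the initial perturbation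
    {𝒦 : (Fin d → ℝ) → ℂ} {ρ𝒦 : ℝ} (h𝒦 : ContDiff ℝ r₀ 𝒦)
    (h𝒦b : ∀ s, s ≤ r₀ → ∀ z : Fin d → ℝ, ‖iteratedFDeriv ℝ s 𝒦 z‖ ≤ ρ𝒦 * Real.exp ((∑ i, z i ^ 2) / 4))
    (h𝒦small : (Real.exp (1 / 4) + 2 * Real.exp (3 / 8)) *
      (ρ𝒦 * Real.exp (fieldWt h (L : ℝ) d 0 / (L : ℝ) ^ 0)) * A ≤ 1 / 2)
    (h𝒦ε : Real.exp (1 / 4) * (ρ𝒦 * Real.exp (fieldWt h (L : ℝ) d 0 / (L : ℝ) ^ 0)) * A ≤ ε)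
    -- the tuning map
    (qmap : HamSpace ℂ d (fieldWt h (L : ℝ) d 0) ((L : ℝ) ^ 0) (L ^ (d * 0)) → Matrix (Fin d) (Fin d) ℝ)
    (hqsymm : ∀ x, (qmap x).IsSymm) (hqT : ∀ x, ∑ i, ∑ j, |qmap x i j| ≤ T₀)
    {Lq : ℝ} (hLq : 0 ≤ Lq)
    (hqlip : ∀ x x', ‖x‖ ≤ ρ → ‖x'‖ ≤ ρ → ∑ i, ∑ j, |(qmap x - qmap x') i j| ≤ Lq * ‖x - x'‖)
    -- (12.53): the `S_k`-comparison in the tuning parameter (HYPOTHESIS)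
    {lT : ℝ} (hlT : 0 ≤ lT)
    (hl : ∀ (q q' : Matrix (Fin d) (Fin d) ℝ), q.IsSymm → q'.IsSymm →
      ∑ i, ∑ j, |q i j| ≤ T₀ → ∑ i, ∑ j, |q' i j| ≤ T₀ → ∀ k, k + 1 ≤ N →
      ∀ (u : HamSpace ℂ d (fieldWt h (L : ℝ) d k) ((L : ℝ) ^ k) (L ^ (d * k)))
        (v : activitySpace (abkmNormParams L N Mord R pT r₀ h θbar A (schedDelta δ₀ δ₁ N) fun j => 𝒞 1 j) k)
        (cv : ℝ), ‖u‖ ≤ r →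
        activityNormLE (abkmNormParams L N Mord R pT r₀ h θbar A (schedDelta δ₀ δ₁ N) fun j => 𝒞 1 j) k v cv →
        cv ≤ r →
        activityNormLE (abkmNormParams L N Mord R pT r₀ h θbar A (schedDelta δ₀ δ₁ N) fun j => 𝒞 1 j) (k + 1)
          (rgSQ (L := L) (N := N) (Mord := Mord) (R := R) (p := pT) (r₀ := r₀) (h := h) (θbar := θbar) (A := A)
              (δ₀ := δ₀) (δ₁ := δ₁) (𝒞 := fun j => 𝒞 1 j) (fun j => 𝒞 ((1 : Matrix (Fin d) (Fin d) ℝ) + q) j) k u v -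
            rgSQ (L := L) (N := N) (Mord := Mord) (R := R) (p := pT) (r₀ := r₀) (h := h) (θbar := θbar) (A := A)
              (δ₀ := δ₀) (δ₁ := δ₁) (𝒞 := fun j => 𝒞 1 j) (fun j => 𝒞 ((1 : Matrix (Fin d) (Fin d) ℝ) + q') j) k u v)
          (lT * (∑ i, ∑ j, |(q - q') i j|) * max ‖u‖ cv)) :
    ∃ x₀ : HamSpace ℂ d (fieldWt h (L : ℝ) d 0) ((L : ℝ) ^ 0) (L ^ (d * 0)), ‖x₀‖ ≤ ρ ∧
      ∃ x : ∀ k, HamSpace ℂ d (fieldWt h (L : ℝ) d k) ((L : ℝ) ^ k) (L ^ (d * k)),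
        RGFlow.IsTunedQ (E := fun k => HamSpace ℂ d (fieldWt h (L : ℝ) d k) ((L : ℝ) ^ k) (L ^ (d * k)))
            (F := fun k => activitySpace (abkmNormParams L N Mord R pT r₀ h θbar A (schedDelta δ₀ δ₁ N) fun j => 𝒞 1 j) k)
            N (rgA L h (fun j => 𝒞 ((1 : Matrix (Fin d) (Fin d) ℝ) + qmap x₀) j))
            (rgBT hd hMord hMR hLodd hL hM hθbar hlam hn hn2 hnñ hc hC1 hallA hB pT r₀ hr₀ A hθ0 hθ hT₀ hKT₀ (qmap x₀))
            (rgSQ (L := L) (N := N) (Mord := Mord) (R := R) (p := pT) (r₀ := r₀) (h := h) (θbar := θbar) (A := A)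
              (δ₀ := δ₀) (δ₁ := δ₁) (𝒞 := fun j => 𝒞 1 j) (fun j => 𝒞 ((1 : Matrix (Fin d) (Fin d) ℝ) + qmap x₀) j))
            (initAct (N := N) (Mord := Mord) (R := R) (p := pT) (r₀ := r₀) (θbar := θbar) (A := A) (δ₀ := δ₀)
              (δ₁ := δ₁) (𝒞 := fun j => 𝒞 1 j) 𝒦 x₀) x ∧
          RGFlow.InTubeQ (E := fun k => HamSpace ℂ d (fieldWt h (L : ℝ) d k) ((L : ℝ) ^ k) (L ^ (d * k)))
            (F := fun k => activitySpace (abkmNormParams L N Mord R pT r₀ h θbar A (schedDelta δ₀ δ₁ N) fun j => 𝒞 1 j) k)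
            N η ε (activityNormLE (abkmNormParams L N Mord R pT r₀ h θbar A (schedDelta δ₀ δ₁ N) fun j => 𝒞 1 j))
            (rgSQ (L := L) (N := N) (Mord := Mord) (R := R) (p := pT) (r₀ := r₀) (h := h) (θbar := θbar) (A := A)
              (δ₀ := δ₀) (δ₁ := δ₁) (𝒞 := fun j => 𝒞 1 j) (fun j => 𝒞 ((1 : Matrix (Fin d) (Fin d) ℝ) + qmap x₀) j))
            (initAct (N := N) (Mord := Mord) (R := R) (p := pT) (r₀ := r₀) (θbar := θbar) (A := A) (δ₀ := δ₀)
              (δ₁ := δ₁) (𝒞 := fun j => 𝒞 1 j) 𝒦 x₀) x ∧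
          x 0 = x₀ := by
  have hh : 0 < h := Fact.out
  have hd2 : 2 ≤ d := by omega
  have hA0 : 0 < A := by linarith
  set P := abkmNormParams L N Mord R pT r₀ h θbar A (schedDelta δ₀ δ₁ N) fun j => 𝒞 1 j with hP
  have hPA : 0 < P.A := hA0
  set 𝒞s : Matrix (Fin d) (Fin d) ℝ → ℕ → (Fin d → ZMod M) → ℝ :=
    fun q j => 𝒞 ((1 : Matrix (Fin d) (Fin d) ℝ) + q) j with h𝒞s
  set ball : Set (Matrix (Fin d) (Fin d) ℝ) := {q | q.IsSymm ∧ ∑ i, ∑ j, |q i j| ≤ T₀} with hball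
  set dist : Matrix (Fin d) (Fin d) ℝ → Matrix (Fin d) (Fin d) ℝ → ℝ :=
    fun q q' => ∑ i, ∑ j, |(q - q') i j| with hdist
  have hA𝒫0 : 0 ≤ A𝒫' := by
    rw [← hA𝒫']
    exact zero_le_one.trans (one_le_weightIntConstRho hθbar hθ0 hθ
      (traceConst_nonneg d Mord R hlam.le (derivSum_nonneg d n _)))
  set C87 := pi2BoundConst d (((2 * R + 2 : ℕ) : ℝ) + ((d / 2 + 1 : ℕ) : ℝ)) with hC87def
  have hC87 : 0 ≤ C87 := pi2BoundConst_nonneg d (by positivity)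
  have hβ : 0 ≤ (L : ℝ) ^ d * (C87 * (A𝒫' * A⁻¹)) := by positivity
  -- `hb` at the tuning-parameter level
  obtain ⟨bT, hbT0, hbT⟩ := exists_norm_rgBQ_sub_le_of_torusFRD (h := h) hd hMord hMR hLodd hL hM hθbar hlam hn hn2
    hnñ hc hC1 hallA hB hpM hr₀ hA1 hθ0 hθ hT₀ hKT₀ (pT := pT)
  -- the predicates
  have hQ : RGFlow.IsSubaddNormBound (F := fun k => activitySpace P k) (activityNormLE P) :=
    isSubaddNormBound_activityNormLE P hPA
  have hQnn : ∀ k, k < N → ∀ (v : activitySpace P k) (cv : ℝ), activityNormLE P k v cv → 0 ≤ cv := by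
    intro k hk v cv hv
    have hMt : M = P.L ^ k * L ^ (N - k) := by
      show M = L ^ k * L ^ (N - k)
      rw [hM, ← pow_add, Nat.add_sub_cancel' (by omega)]
    exact nonneg_of_weakNormLE hPA hMt hLodd.pow hLodd.pow hv
  have hρ8 : ρ ≤ 1 / 8 := hρ16.trans (by norm_num)
  -- apply the parametrised Lemma 12.6
  have hmain := RGFlow.exists_isTunedQ_initial_eq_of_parametrised
    (E := fun k => HamSpace ℂ d (fieldWt h (L : ℝ) d k) ((L : ℝ) ^ k) (L ^ (d * k)))
    (F := fun k => activitySpace P k) (Q := activityNormLE P)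
    (A := fun q => rgA L h (𝒞s q))
    (B := fun q => rgBT hd hMord hMR hLodd hL hM hθbar hlam hn hn2 hnñ hc hC1 hallA hB pT r₀ hr₀ A hθ0 hθ hT₀ hKT₀ q)
    (S := fun q => rgSQ (L := L) (N := N) (Mord := Mord) (R := R) (p := pT) (r₀ := r₀) (h := h) (θbar := θbar)
      (A := A) (δ₀ := δ₀) (δ₁ := δ₁) (𝒞 := fun j => 𝒞 1 j) (𝒞s q))
    (y₀ := initAct (N := N) (Mord := Mord) (R := R) (p := pT) (r₀ := r₀) (θbar := θbar) (A := A) (δ₀ := δ₀)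
      (δ₁ := δ₁) (𝒞 := fun j => 𝒞 1 j) 𝒦)
    (r := r) (α := 3 / 4) (β := (L : ℝ) ^ d * (C87 * (A𝒫' * A⁻¹))) (σ := sigmaABKM d L R A A𝒫' r)
    (η := η) (κ := κ) (ε := ε) (ρ := ρ)
    (a₁ := (secondDiffConst (fun α => Cα α 1) + 1) / (4 * h ^ 2)) (b₁ := bT) (l₁ := lT)
    (m₀ := 16 * Real.exp (3 / 8) * (ρ𝒦 * Real.exp (fieldWt h (L : ℝ) d 0 / (L : ℝ) ^ 0)) * A)
    (c₀ := Real.exp (1 / 4) * (ρ𝒦 * Real.exp (fieldWt h (L : ℝ) d 0 / (L : ℝ) ^ 0)) * A) (Lq := Lq)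
    dist ball qmap hQ hQnn hη hη1 (by norm_num) hβ hκ₁ hκ₂ hκ hε hεr hερ
    (div_nonneg (by linarith [secondDiffConst_nonneg (d := d) (fun α => Cα α 1)]) (by positivity)) hbT0 hlT hLq
    h𝒦ε (fun x _ => ⟨hqsymm x, hqT x⟩) (fun x x' hx hx' => hqlip x x' hx hx') ?_ ?_ ?_ ?_ ?_ ?_
  · -- read off the conclusion
    obtain ⟨x₀, hx₀, x, htuned, htube, hx0⟩ := hmain
    exact ⟨x₀, hx₀, x, htuned, htube, hx0⟩
  · -- `hT`: Theorem 6.8 for every `q` in the ball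
    rintro q ⟨hq, hqT'⟩
    have hS := stepKernelBounds_family_of_torusFRD hd hMord hMR hLodd hL hθbar hlam hn hn2 hnñ hc hC1 hallA hB
      hθ0 hθ hT₀ hKT₀ hq hqT'
    have hT := isRGStepQ_abkm_of_stepKernelBounds (p := pT) (𝒞s := 𝒞s q) hd hLodd hL hR2 hM hp hpM hMR hr₀ hB hδ₀ hδ₁
      hh hh0 hS hh2 (hA𝒫' ▸ hA𝒫0) hA1 (hA𝒫' ▸ hA𝒫A) (hA𝒫' ▸ hsmall) hr0 hr (hA𝒫' ▸ hv) (hA𝒫' ▸ hωA)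
      (hA𝒫' ▸ hc3A) (hA𝒫' ▸ hc2A)
    simp only [rgBT_of_mem (h := h) hd hMord hMR hLodd hL hM hθbar hlam hn hn2 hnñ hc hC1 hallA hB pT r₀ hr₀ A hθ0 hθ
      hT₀ hKT₀ hq hqT']
    rw [← hA𝒫']
    exact hT
  · -- `hy₀`
    intro x hx
    have h2 : Real.exp (1 / 4) ≤ Real.exp (1 / 4) + 2 * Real.exp (3 / 8) := by
      have := Real.exp_pos (3 / 8 : ℝ); linarith
    have hρ𝒦 : 0 ≤ ρ𝒦 := by
      have h0 := (norm_nonneg _).trans (h𝒦b 0 (Nat.zero_le _) 0)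
      exact (mul_nonneg_iff_of_pos_right (Real.exp_pos _)).1 h0
    have h3 : Real.exp (1 / 4) * (ρ𝒦 * Real.exp (fieldWt h (L : ℝ) d 0 / (L : ℝ) ^ 0)) * A ≤
        (Real.exp (1 / 4) + 2 * Real.exp (3 / 8)) * (ρ𝒦 * Real.exp (fieldWt h (L : ℝ) d 0 / (L : ℝ) ^ 0)) * A :=
      mul_le_mul_of_nonneg_right (mul_le_mul_of_nonneg_right h2 (mul_nonneg hρ𝒦 (Real.exp_pos _).le)) hA0.le
    have h1 : Real.exp (1 / 4) * (ρ𝒦 * Real.exp (fieldWt h (L : ℝ) d 0 / (L : ℝ) ^ 0)) * A ≤ 1 :=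
      h3.trans (h𝒦small.trans (by norm_num))
    exact activityNormLE_initAct hd2 hLodd hM (by omega) (by omega) hB hδ₀ hδ₁ hh hh0 hA0 h𝒦 h𝒦b h1 x (hx.trans hρ8)
  · -- `ha`: (12.51)
    rintro q q' ⟨hq, hqT'⟩ ⟨hq', hq'T'⟩ k hk w
    exact norm_rgA_symm_one_add_sub_le_of_torusFRD (fun A hA => (hallA A hA).2.2.2.2.1) hd2 hn2 hq' hq
      (hq'T'.trans hT₀) (hqT'.trans hT₀) (by omega) w
  · -- `hb`: (12.52)
    rintro q q' ⟨hq, hqT'⟩ ⟨hq', hq'T'⟩ k hk v cv hv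
    simp only [rgBT_of_mem (h := h) hd hMord hMR hLodd hL hM hθbar hlam hn hn2 hnñ hc hC1 hallA hB pT r₀ hr₀ A hθ0
      hθ hT₀ hKT₀ hq hqT', rgBT_of_mem (h := h) hd hMord hMR hLodd hL hM hθbar hlam hn hn2 hnñ hc hC1 hallA hB pT r₀
      hr₀ A hθ0 hθ hT₀ hKT₀ hq' hq'T']
    exact hbT q' q hq' hq hq'T' hqT' k (by omega) v cv hv
  · -- `hl`: (12.53), the hypothesis
    rintro q q' ⟨hq, hqT'⟩ ⟨hq', hq'T'⟩ k hk u v cv hu hv hcv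
    exact hl q q' hq hq' hqT' hq'T' k (by omega) u v cv hu hv hcv
  · -- `hm`: Lemma 12.2
    intro x x' hx hx'
    exact activityNormLE_initAct_sub hd2 hLodd hM (by omega) (by omega) hB hδ₀ hδ₁ hh hh0 hA0 h𝒦 h𝒦b h𝒦small
      x x' (hx.trans hρ16) (hx'.trans hρ16)

end Package

end Literature.MathematicalPhysics.StatisticalMechanics.GradientRG

end
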